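import Mathlib.Analysis.Complex.CoveringMap
import Mathlib.Analysis.SpecialFunctions.Complex.LogDeriv
import Mathlib.Analysis.SpecialFunctions.Complex.Arg
import Mathlib.Topology.Homotopy.Lifting
import Literature.Topology.FourManifolds.ClosedBall
import Literature.Topology.FourManifolds.TorusCoordinates
import Summits.SmoothPoincare4.SmoothPoincare4.Theses.DottedCircleRasmussen

/-!
# Helper `helper_friendsCarrier_Vk_partA_angleLift` (piece 2 of the registered stub
`helper_friendsCarrier_Vk_partA`, line `mk_friends`, skeleton v8) for crux `DcrGap`
(item stmt-SmoothPoincare4-16128, route route-SmoothPoincare4-DottedCircleRasmussen)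

**A smooth polar angle for a radial plane field whose boundary loop is null-homotopic in `ℂ ∖ 0`.**
In Part A of V_k (the framing theorem) the topological input — the tube of the model knot induces the
disc framing — arrives as a free null-homotopy, in `ℂ ∖ 0`, of the first column `u ↦ a(u) + i c(u)` of
the loop of matrices comparing the prescribed boundary frame with a trivialisation of the normal bundle
of the disc.  The frame-extension formula (`…VkPartAFrameExt`) wants instead a `C^∞` polar angle `θ` with
`a + i c = |a + i c| e^{iθ}` off the origin (the coefficients being extended radially to `ℝ² ∖ 0`).  This
file passes from the one to the other:

* homotopy lifting for the covering `exp : ℂ → ℂ ∖ 0` (Mathlib's `Complex.isCoveringMap_exp`,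
  `IsCoveringMap.liftHomotopy`, Hatcher Prop. 1.30), started at the constant end of the null-homotopy,
  gives a continuous logarithm `L` of the loop on the circle, whence a continuous angle `Im L ∘ (x/|x|)`
  of the radial field off the origin;
* a continuous angle of a `C^∞` nowhere-zero field is `C^∞`: near `x₀` it differs from the smooth local
  angle `θ(x₀) + arg (g(x)/g(x₀))` (tree: `contDiffAt_arg`, `TorusCoordinates.lean`) by a continuous
  multiple of `2π` vanishing at `x₀`.

* `FriendsCarrierVk.exists_angleLift` / `helper_friendsCarrier_Vk_partA_angleLift` — the statement.

No definitions, no named facts, no `sorry`.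

## References

* A. Hatcher, *Algebraic Topology*, CUP (2002), Prop. 1.30 (homotopy lifting), proof of Thm. 1.7.
  [HatcherAT2002]
-/

-- the prescribed namespace `Summit.<P>.<Sub>.…` duplicates `SmoothPoincare4` (P = Sub)
set_option linter.dupNamespace false
set_option linter.style.longLine false

noncomputable section

open scoped ContDiff Topology
open Set Function Metric Filter Complex Literature.Topology.FourManifolds

namespace Summit.SmoothPoincare4.SmoothPoincare4.Theorems.DcrGap.MkFriends

namespace FriendsCarrierVk

/-- `e^{iθ} = 1` with `|θ| < 1` forces `θ = 0`. [folklore] -/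
theorem eq_zero_of_exp_mul_I_eq_one {t : ℝ} (h : exp (t * I) = 1) (ht : |t| < 1) : t = 0 := by
  obtain ⟨n, hn⟩ := Complex.exp_eq_one_iff.1 h
  have h2 : t = n * (2 * Real.pi) := by
    have := congrArg Complex.im hn
    simpa using this
  have hpi : 3 < Real.pi := Real.pi_gt_three
  rcases lt_trichotomy n 0 with hn0 | hn0 | hn0
  · have : (n : ℝ) ≤ -1 := by exact_mod_cast Int.le_sub_one_of_lt hn0
    rw [h2, abs_lt] at ht
    nlinarith
  · rw [h2, hn0]; simp
  · have : (1 : ℝ) ≤ n := by exact_mod_cast hn0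
    rw [h2, abs_lt] at ht
    nlinarith

/-- **A smooth polar angle off the origin for a radial nowhere-zero plane field whose boundary loop is
freely null-homotopic in `ℂ ∖ 0`.** [cite: HatcherAT2002, Prop. 1.30] -/
theorem exists_angleLift (g : EuclideanSpace ℝ (Fin 2) → ℂ) (hg : ∀ x, x ≠ 0 → ContDiffAt ℝ ∞ g x)
    (hg0 : ∀ x, x ≠ 0 → g x ≠ 0) (hrad : ∀ x, x ≠ 0 → g x = g (‖x‖⁻¹ • x))
    (hH : ∃ H : unitInterval × (sphere (0 : EuclideanSpace ℝ (Fin 2)) 1) → ℂ, Continuous H ∧ (∀ p, H p ≠ 0) ∧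
      (∀ u, H (0, u) = g u) ∧ ∃ z : ℂ, ∀ u, H (1, u) = z) :
    ∃ θ : EuclideanSpace ℝ (Fin 2) → ℝ, (∀ x, x ≠ 0 → ContDiffAt ℝ ∞ θ x) ∧
      ∀ x, x ≠ 0 → g x = (‖g x‖ : ℂ) * exp ((θ x : ℂ) * I) := by
  obtain ⟨H, hHc, hH0, hHg, z, hHz⟩ := hH
  -- a point of the circle
  let u₀ : sphere (0 : EuclideanSpace ℝ (Fin 2)) 1 := ⟨EuclideanSpace.single 0 1, by simp⟩
  have hz0 : z ≠ 0 := by rw [← hHz u₀]; exact hH0 _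
  -- the covering `exp : ℂ → ℂ ∖ 0`
  let p : ℂ → {w : ℂ // w ≠ 0} := fun ζ => ⟨exp ζ, exp_ne_zero ζ⟩
  have hp : IsCoveringMap p := Complex.isCoveringMap_exp
  -- the reversed null-homotopy, from the constant `z` to the loop `g|_{S¹}`
  let H' : C(unitInterval × (sphere (0 : EuclideanSpace ℝ (Fin 2)) 1), {w : ℂ // w ≠ 0}) :=
    ⟨fun q => ⟨H (unitInterval.symm q.1, q.2), hH0 _⟩,
      (hHc.comp ((unitInterval.continuous_symm.comp continuous_fst).prodMk continuous_snd)).subtype_mk _⟩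
  let f : C((sphere (0 : EuclideanSpace ℝ (Fin 2)) 1), ℂ) := ContinuousMap.const _ (log z)
  have H'0 : ∀ u, H' (0, u) = p (f u) := fun u => Subtype.ext (by
    simp [H', f, p, unitInterval.symm_zero, hHz, exp_log hz0])
  set G : C(unitInterval × (sphere (0 : EuclideanSpace ℝ (Fin 2)) 1), ℂ) := hp.liftHomotopy H' f H'0 with hGdef
  have hG : ∀ q, exp (G q) = ((H' q : {w : ℂ // w ≠ 0}) : ℂ) := fun q =>
    congrArg Subtype.val (congrFun (hp.liftHomotopy_lifts H' f H'0) q)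
  -- the continuous logarithm of the loop
  set L : (sphere (0 : EuclideanSpace ℝ (Fin 2)) 1) → ℂ := fun u => G (1, u) with hLdef
  have hL : ∀ u, exp (L u) = g u := fun u => by
    rw [hLdef, hG]
    simp [H', unitInterval.symm_one, hHg]
  have hLc : Continuous L := G.continuous.comp (continuous_const.prodMk continuous_id)
  -- the angle off the origin
  set θ : EuclideanSpace ℝ (Fin 2) → ℝ := fun x => (L (radialProjection u₀ x)).im with hθdef
  have hgπ : ∀ x, x ≠ 0 → g x = exp (L (radialProjection u₀ x)) := fun x hx => by
    rw [hL, coe_radialProjection_of_ne_zero u₀ hx]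
    exact hrad x hx
  have hpolar : ∀ x, x ≠ 0 → g x = (‖g x‖ : ℂ) * exp ((θ x : ℂ) * I) := fun x hx => by
    have h1 := hgπ x hx
    have hn : ‖g x‖ = Real.exp (L (radialProjection u₀ x)).re := by rw [h1, norm_exp]
    rw [hn, Complex.ofReal_exp, ← Complex.exp_add, hθdef, re_add_im]
    exact h1
  have hθc : ∀ x, x ≠ 0 → ContinuousAt θ x := fun x hx =>
    (continuous_im.comp hLc).continuousAt.comp
      ((continuousOn_radialProjection u₀).continuousAt (isOpen_ne.mem_nhds hx))
  refine ⟨θ, fun x₀ hx₀ => ?_, hpolar⟩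
  -- smoothness at `x₀ ≠ 0`: compare with the smooth local angle `θ x₀ + arg (g x / g x₀)`
  have hg00 := hg0 x₀ hx₀
  set θ' : EuclideanSpace ℝ (Fin 2) → ℝ := fun x => θ x₀ + arg (g x / g x₀) with hθ'def
  have hw : ContDiffAt ℝ ∞ (fun x => g x / g x₀) x₀ := (hg x₀ hx₀).div_const _
  have hθ's : ContDiffAt ℝ ∞ θ' x₀ := by
    refine contDiffAt_const.add ?_
    have h1 : g x₀ / g x₀ ∈ slitPlane := by rw [div_self hg00]; exact one_mem_slitPlane
    exact (contDiffAt_arg h1).comp x₀ hw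
  refine hθ's.congr_of_eventuallyEq ?_
  -- `θ - θ'` is a continuous multiple of `2π` vanishing at `x₀`
  have hD0 : θ x₀ - θ' x₀ = 0 := by simp [hθ'def, div_self hg00]
  have hDc : ContinuousAt (fun x => θ x - θ' x) x₀ := (hθc x₀ hx₀).sub hθ's.continuousAt
  have hsmall : ∀ᶠ x in 𝓝 x₀, |θ x - θ' x| < 1 := by
    have := hDc.eventually (Metric.ball_mem_nhds (θ x₀ - θ' x₀) one_pos)
    filter_upwards [this] with x hx
    have hx' : dist (θ x - θ' x) (θ x₀ - θ' x₀) < 1 := hx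
    rwa [hD0, Real.dist_eq, sub_zero] at hx'
  filter_upwards [hsmall, isOpen_ne.mem_nhds hx₀] with x hx hxne
  have hgx := hg0 x hxne
  -- `exp (i θ x) = g x / |g x|` and `exp (i θ' x) = g x / |g x|`
  have e1 : exp ((θ x : ℂ) * I) = g x / ‖g x‖ := by
    have h := hpolar x hxne
    have hn : ((‖g x‖ : ℝ) : ℂ) ≠ 0 := by exact_mod_cast (norm_ne_zero_iff.2 hgx)
    rw [eq_div_iff hn, mul_comm]; exact h.symm
  have e2 : exp ((θ' x : ℂ) * I) = g x / ‖g x‖ := by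
    have hw0 : g x / g x₀ ≠ 0 := div_ne_zero hgx hg00
    have h0 := hpolar x₀ hx₀
    have hA := norm_mul_exp_arg_mul_I (g x / g x₀)
    have hn0 : ((‖g x₀‖ : ℝ) : ℂ) ≠ 0 := by exact_mod_cast (norm_ne_zero_iff.2 hg00)
    have hn : ((‖g x‖ : ℝ) : ℂ) ≠ 0 := by exact_mod_cast (norm_ne_zero_iff.2 hgx)
    have hnw : ((‖g x / g x₀‖ : ℝ) : ℂ) ≠ 0 := by exact_mod_cast (norm_ne_zero_iff.2 hw0)
    have h0' : exp ((θ x₀ : ℂ) * I) = g x₀ / ‖g x₀‖ := by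
      rw [eq_div_iff hn0, mul_comm]; exact h0.symm
    have hA' : exp ((arg (g x / g x₀) : ℂ) * I) = (g x / g x₀) / ‖g x / g x₀‖ := by
      rw [eq_div_iff hnw, mul_comm]; exact hA
    have : ((θ' x : ℝ) : ℂ) * I = (θ x₀ : ℂ) * I + (arg (g x / g x₀) : ℂ) * I := by
      simp only [hθ'def]; push_cast; ring
    rw [this, Complex.exp_add, h0', hA', norm_div]
    push_cast
    field_simp
  have e3 : exp (((θ x - θ' x : ℝ) : ℂ) * I) = 1 := by
    have : ((θ x - θ' x : ℝ) : ℂ) * I = (θ x : ℂ) * I - (θ' x : ℂ) * I := by push_cast; ring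
    rw [this, Complex.exp_sub, e1, e2, div_self]
    exact div_ne_zero hgx (by exact_mod_cast (norm_ne_zero_iff.2 hgx))
  have := eq_zero_of_exp_mul_I_eq_one e3 hx
  linarith

end FriendsCarrierVk

open FriendsCarrierVk in
/-- **Helper `helper_friendsCarrier_Vk_partA_angleLift`** (piece of `helper_friendsCarrier_Vk_partA`: a smooth
polar angle from a null-homotopy).  Let `g : ℝ² → ℂ` be `C^∞` and nowhere zero off the origin and radial
(`g x = g (x/|x|)`), and suppose its restriction to the unit circle is freely null-homotopic in `ℂ ∖ 0`.
Then `g = |g| e^{iθ}` off the origin for a function `θ` of class `C^∞` off the origin.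
[cite: HatcherAT2002, Prop. 1.30] -/
theorem helper_friendsCarrier_Vk_partA_angleLift : ∀ (g : EuclideanSpace ℝ (Fin 2) → ℂ), (∀ x, x ≠ 0 → ContDiffAt ℝ ((⊤ : ℕ∞) : WithTop ℕ∞) g x) → (∀ x, x ≠ 0 → g x ≠ 0) → (∀ x, x ≠ 0 → g x = g (‖x‖⁻¹ • x)) → (∃ H : unitInterval × (Metric.sphere (0 : EuclideanSpace ℝ (Fin 2)) 1) → ℂ, Continuous H ∧ (∀ p, H p ≠ 0) ∧ (∀ u, H (0, u) = g u) ∧ ∃ z : ℂ, ∀ u, H (1, u) = z) → ∃ θ : EuclideanSpace ℝ (Fin 2) → ℝ, (∀ x, x ≠ 0 → ContDiffAt ℝ ((⊤ : ℕ∞) : WithTop ℕ∞) θ x) ∧ ∀ x, x ≠ 0 → g x = ((‖g x‖ : ℝ) : ℂ) * Complex.exp (((θ x : ℝ) : ℂ) * Complex.I) :=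
  exists_angleLift

end Summit.SmoothPoincare4.SmoothPoincare4.Theorems.DcrGap.MkFriends

end
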